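import Literature.NumberTheory.ModularForms.LogLambda
import Literature.NumberTheory.ModularForms.QuasimodularPhi
import HarnessLib

/-!
# The dual bases `φ̃ⱼ`, `ψ̃ⱼ` of CKMRV Propositions 4.4–4.5 and the systems (4.9), (4.11)

Cohn–Kumar–Miller–Radchenko–Viazovska, Ann. of Math. 196 (2022) = arXiv:1902.05438, §4.2.

* Proposition 4.4: the solutions in `𝓟` of (4.9) `f|ₖ(T − 2 + T⁻¹ − 2S) = 0`, `f|ₖ(I − STS) = 0`
  form `φ̃₂ M_{k−2} + φ̃₀ M_k + φ̃₋₂ M_{k+2}` with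
  "`φ̃₂(z) = z²((E₂|₂S)(z))²`, `φ̃₀(z) = z²(E₂|₂S)(z)`, and `φ̃₋₂(z) = z²`".
* Proposition 4.5: the solutions in `𝓟` of (4.11) `f|ₖ(T − 2 + T⁻¹ + 2S) = 0`,
  `f|ₖ(I + STS) = 0` form `ψ̃₄ M_{k−4} + ψ̃₂ M_{k−2} + ψ̃₀ M_k` with
  "`ψ̃₄ = U² − V²`, `ψ̃₂ = W`, and `ψ̃₀ = 𝓛`".

As for Propositions 4.2–4.3 (`QuasimodularPhi.lean`, `QuasimodularPsi.lean`) we vendor the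
DEFINITIONS (`phiTildeNeg2/phiTilde0/phiTilde2`, `psiTilde4/psiTilde2/psiTilde0`, the systems
`IsAnnPlusDual`, `IsAnnMinusDual`) and PROVE the easy inclusions ("The other aspects of the proof
are straightforward to verify as above"): for a `T`- and `S`-invariant `f` of weight `k − j`,
`φ̃ⱼ f` solves (4.9) and `ψ̃ⱼ f` solves (4.11). Here `(E₂|₂S)(z) = E₂(z) − 6i/(πz)`
(`E2_slash_S_apply`), so `φ̃₀(z) = z²E₂(z) − 6iz/π = E₂(−1/z)` and `φ̃₂(z) = (zE₂(z) − 6i/π)²`.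
The reverse inclusions (uniqueness) are not vendored.

## References

* H. Cohn, A. Kumar, S. D. Miller, D. Radchenko, M. Viazovska, Ann. of Math. 196 (2022),
  arXiv:1902.05438, §4.2 Propositions 4.4–4.5, (4.9)–(4.12). [CohnEtAl2019]
-/

noncomputable section

open Complex hiding I
open Filter Topology ModularForm SlashInvariantForm EisensteinSeries
open UpperHalfPlane hiding I
open Complex (I)
open scoped Real MatrixGroups ModularForm Manifold

namespace Literature.NumberTheory.ModularForms

/-! ## Slashing by `T⁻¹` -/

/-- If `F|ₖT = G` then `G|ₖT⁻¹ = F`. [folklore] -/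
theorem slash_T_inv_eq_of_slash_T {k : ℤ} {F G : ℍ → ℂ} (h : F ∣[k] ModularGroup.T = G) :
    G ∣[k] ModularGroup.T⁻¹ = F := by
  rw [← h, ← SlashAction.slash_mul, mul_inv_cancel, SlashAction.slash_one]

/-- A `T`-invariant function is `T⁻¹`-invariant. [folklore] -/
theorem slash_T_inv_of_invariant {k : ℤ} {f : ℍ → ℂ} (h : f ∣[k] ModularGroup.T = f) :
    f ∣[k] ModularGroup.T⁻¹ = f :=
  slash_T_inv_eq_of_slash_T h

/-- Invariance under `T` does not depend on the weight (it is `1`-periodicity). [folklore] -/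
theorem slash_T_eq_self_iff {k k' : ℤ} {f : ℍ → ℂ} (h : f ∣[k] ModularGroup.T = f) :
    f ∣[k'] ModularGroup.T = f := by
  funext τ
  have := congrFun h τ
  rw [slash_T_apply] at this ⊢
  exact this

/-- From `f|_{k'}S = f`: `f(−1/τ) τ^{−k} = τ^{k'−k} f(τ)`. [folklore] -/
theorem apply_S_smul_mul_zpow {k k' : ℤ} {f : ℍ → ℂ} (h : f ∣[k'] ModularGroup.S = f) (τ : ℍ) :
    f (ModularGroup.S • τ) * (τ : ℂ) ^ (-k) = (τ : ℂ) ^ (k' - k) * f τ := by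
  have hτ : (τ : ℂ) ≠ 0 := τ.ne_zero
  have := congrFun h τ
  rw [slash_S_apply'] at this
  have h1 : f (ModularGroup.S • τ) = f τ * (τ : ℂ) ^ k' := by
    rw [← this, mul_assoc, ← zpow_add₀ hτ, neg_add_cancel, zpow_zero, mul_one]
  rw [h1, mul_assoc, ← zpow_add₀ hτ, show k' + -k = k' - k by ring]
  ring

/-! ## The systems (4.9) and (4.11) -/

/-- **The system (4.9)**: `g|ₖ(T − 2 + T⁻¹ − 2S) = 0` and `g|ₖ(I − STS) = 0` (the right ideal
`𝓘̃₊`). [cite: CohnEtAl2019, §4.2 (4.9)] -/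
structure IsAnnPlusDual (k : ℤ) (g : ℍ → ℂ) : Prop where
  T_eq : g ∣[k] ModularGroup.T - (2 : ℂ) • g + g ∣[k] ModularGroup.T⁻¹ -
    (2 : ℂ) • g ∣[k] ModularGroup.S = 0
  STS_eq : g - ((g ∣[k] ModularGroup.S) ∣[k] ModularGroup.T) ∣[k] ModularGroup.S = 0

/-- **The system (4.11)**: `g|ₖ(T − 2 + T⁻¹ + 2S) = 0` and `g|ₖ(I + STS) = 0` (the right ideal
`𝓘̃₋`). [cite: CohnEtAl2019, §4.2 (4.11)] -/
structure IsAnnMinusDual (k : ℤ) (g : ℍ → ℂ) : Prop where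
  T_eq : g ∣[k] ModularGroup.T - (2 : ℂ) • g + g ∣[k] ModularGroup.T⁻¹ +
    (2 : ℂ) • g ∣[k] ModularGroup.S = 0
  STS_eq : g + ((g ∣[k] ModularGroup.S) ∣[k] ModularGroup.T) ∣[k] ModularGroup.S = 0

/-- Mechanism for (4.9): if `g|S = g₀` with `g₀|T = g₀`, `g₀|S = g`, and
`g|T − 2g + g|T⁻¹ = 2g₀`, then `g` solves (4.9). [folklore] -/
theorem IsAnnPlusDual.of_laws {k : ℤ} {g g₀ : ℍ → ℂ} (hS : g ∣[k] ModularGroup.S = g₀)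
    (h0T : g₀ ∣[k] ModularGroup.T = g₀) (h0S : g₀ ∣[k] ModularGroup.S = g)
    (hT : g ∣[k] ModularGroup.T - (2 : ℂ) • g + g ∣[k] ModularGroup.T⁻¹ = (2 : ℂ) • g₀) :
    IsAnnPlusDual k g :=
  ⟨by rw [hT, hS, sub_self], by rw [hS, h0T, h0S, sub_self]⟩

/-- Mechanism for (4.11): if `g|S = g₀` with `g₀|T = −g₀`, `g₀|S = g`, and
`g|T − 2g + g|T⁻¹ + 2g₀ = 0`, then `g` solves (4.11). [folklore] -/
theorem IsAnnMinusDual.of_laws {k : ℤ} {g g₀ : ℍ → ℂ} (hS : g ∣[k] ModularGroup.S = g₀)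
    (h0T : g₀ ∣[k] ModularGroup.T = -g₀) (h0S : g₀ ∣[k] ModularGroup.S = g)
    (hT : g ∣[k] ModularGroup.T - (2 : ℂ) • g + g ∣[k] ModularGroup.T⁻¹ + (2 : ℂ) • g₀ = 0) :
    IsAnnMinusDual k g :=
  ⟨by rw [hS, hT], by rw [hS, h0T, SlashAction.neg_slash, h0S, add_neg_cancel]⟩

/-! ## `φ̃₋₂ = z²`, `φ̃₀ = z²(E₂|₂S)`, `φ̃₂ = z²(E₂|₂S)²` (Proposition 4.4) -/

/-- **`φ̃₋₂(z) = z²`.** [cite: CohnEtAl2019, §4.2 Proposition 4.4] -/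
def phiTildeNeg2 (z : ℍ) : ℂ := (z : ℂ) ^ 2

/-- **`φ̃₀(z) = z²(E₂|₂S)(z) = z²E₂(z) − 6iz/π`.** [cite: CohnEtAl2019, §4.2 Proposition 4.4] -/
def phiTilde0 (z : ℍ) : ℂ := (z : ℂ) ^ 2 * E2 z - 6 * I * (z : ℂ) / π

/-- **`φ̃₂(z) = z²((E₂|₂S)(z))² = (zE₂(z) − 6i/π)²`.** [cite: CohnEtAl2019, §4.2 Proposition 4.4] -/
def phiTilde2 (z : ℍ) : ℂ := ((z : ℂ) * E2 z - 6 * I / π) ^ 2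

/-- `φ̃₀ = z²(E₂|₂S)` as printed. [cite: CohnEtAl2019, §4.2 Proposition 4.4] -/
theorem phiTilde0_eq (z : ℍ) : phiTilde0 z = (z : ℂ) ^ 2 * (E2 ∣[(2 : ℤ)] ModularGroup.S) z := by
  have hz : (z : ℂ) ≠ 0 := z.ne_zero
  have hπ : (π : ℂ) ≠ 0 := ofReal_ne_zero.2 Real.pi_ne_zero
  rw [phiTilde0, E2_slash_S_apply]
  field_simp

/-- `φ̃₂ = z²((E₂|₂S))²` as printed. [cite: CohnEtAl2019, §4.2 Proposition 4.4] -/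
theorem phiTilde2_eq (z : ℍ) :
    phiTilde2 z = (z : ℂ) ^ 2 * ((E2 ∣[(2 : ℤ)] ModularGroup.S) z) ^ 2 := by
  have hz : (z : ℂ) ≠ 0 := z.ne_zero
  have hπ : (π : ℂ) ≠ 0 := ofReal_ne_zero.2 Real.pi_ne_zero
  rw [phiTilde2, E2_slash_S_apply]
  field_simp

/-- `φ̃₀ = E₂ ∘ S`: `φ̃₀(z) = E₂(−1/z)`. [folklore] -/
theorem phiTilde0_eq_E2_S_smul (z : ℍ) : phiTilde0 z = E2 (ModularGroup.S • z) := by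
  rw [phiTilde0, E2_S_smul]

/-- `φ̃₋₂(S • τ) = τ⁻²`. [folklore] -/
theorem phiTildeNeg2_S_smul (τ : ℍ) : phiTildeNeg2 (ModularGroup.S • τ) = ((τ : ℂ) ^ 2)⁻¹ := by
  rw [phiTildeNeg2, coe_S_smul, neg_pow, inv_pow]; norm_num

/-- `φ̃₀(S • τ) = E₂(τ)`. [folklore] -/
theorem phiTilde0_S_smul (τ : ℍ) : phiTilde0 (ModularGroup.S • τ) = E2 τ := by
  have hτ : (τ : ℂ) ≠ 0 := τ.ne_zero
  have hπ : (π : ℂ) ≠ 0 := ofReal_ne_zero.2 Real.pi_ne_zero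
  rw [phiTilde0, E2_S_smul, coe_S_smul]
  field_simp
  ring

/-- `φ̃₂(S • τ) = τ²E₂(τ)²`. [folklore] -/
theorem phiTilde2_S_smul (τ : ℍ) : phiTilde2 (ModularGroup.S • τ) = (τ : ℂ) ^ 2 * E2 τ ^ 2 := by
  have hτ : (τ : ℂ) ≠ 0 := τ.ne_zero
  have hπ : (π : ℂ) ≠ 0 := ofReal_ne_zero.2 Real.pi_ne_zero
  rw [phiTilde2, E2_S_smul, coe_S_smul]
  field_simp
  ring

/-- `φ̃ⱼ(τ+1) + φ̃ⱼ(τ−1) − 2φ̃ⱼ(τ)`: for `φ̃₋₂` it is `2`. [folklore] -/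
theorem phiTildeNeg2_second_diff (τ : ℍ) :
    phiTildeNeg2 ((1 : ℝ) +ᵥ τ) - 2 * phiTildeNeg2 τ + phiTildeNeg2 ((-1 : ℝ) +ᵥ τ) = 2 := by
  simp only [phiTildeNeg2, coe_vadd]; push_cast; ring

/-- `E₂(τ − 1) = E₂(τ)`. [folklore] -/
theorem E2_vadd_neg_one (τ : ℍ) : E2 ((-1 : ℝ) +ᵥ τ) = E2 τ := by
  have := E2_vadd_one ((-1 : ℝ) +ᵥ τ)
  rw [vadd_vadd] at this
  norm_num at this
  exact this.symm

/-- For `φ̃₀` the second difference is `2E₂`. [folklore] -/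
theorem phiTilde0_second_diff (τ : ℍ) :
    phiTilde0 ((1 : ℝ) +ᵥ τ) - 2 * phiTilde0 τ + phiTilde0 ((-1 : ℝ) +ᵥ τ) = 2 * E2 τ := by
  simp only [phiTilde0, E2_vadd_one, E2_vadd_neg_one, coe_vadd]; push_cast; ring

/-- For `φ̃₂` the second difference is `2E₂²`. [folklore] -/
theorem phiTilde2_second_diff (τ : ℍ) :
    phiTilde2 ((1 : ℝ) +ᵥ τ) - 2 * phiTilde2 τ + phiTilde2 ((-1 : ℝ) +ᵥ τ) = 2 * E2 τ ^ 2 := by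
  simp only [phiTilde2, E2_vadd_one, E2_vadd_neg_one, coe_vadd]; push_cast; ring

/-- Pointwise form of `|ₖT⁻¹`: `(g|ₖT⁻¹)(τ) = g(τ − 1)`. [folklore] -/
theorem slash_T_inv_apply (g : ℍ → ℂ) (k : ℤ) (τ : ℍ) :
    (g ∣[k] ModularGroup.T⁻¹) τ = g ((-1 : ℝ) +ᵥ τ) := by
  have hsm : ModularGroup.T⁻¹ • τ = (-1 : ℝ) +ᵥ τ := by
    rw [show ModularGroup.T⁻¹ = ModularGroup.T ^ (-1 : ℤ) by simp, modular_T_zpow_smul]; simp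
  rw [SL_slash_apply, hsm, ModularGroup.denom_apply, ModularGroup.coe_T_inv]
  simp

/-- The generic verification of (4.9) for `g = φ̃ f`: given the pointwise laws
`φ̃(S•τ) τ^{j} = Φ(τ)` … (internal). [folklore] -/
theorem isAnnPlusDual_of_pointwise {k : ℤ} {φ Φ f : ℍ → ℂ}
    (hfT : ∀ τ : ℍ, f ((1 : ℝ) +ᵥ τ) = f τ) (hfT' : ∀ τ : ℍ, f ((-1 : ℝ) +ᵥ τ) = f τ)
    (hgS : ∀ τ : ℍ, φ (ModularGroup.S • τ) * f (ModularGroup.S • τ) * (τ : ℂ) ^ (-k) = Φ τ * f τ)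
    (hΦT : ∀ τ : ℍ, Φ ((1 : ℝ) +ᵥ τ) = Φ τ)
    (h0S : ∀ τ : ℍ, Φ (ModularGroup.S • τ) * f (ModularGroup.S • τ) * (τ : ℂ) ^ (-k) = φ τ * f τ)
    (hdiff : ∀ τ : ℍ, φ ((1 : ℝ) +ᵥ τ) - 2 * φ τ + φ ((-1 : ℝ) +ᵥ τ) = 2 * Φ τ) :
    IsAnnPlusDual k (φ * f) := by
  refine IsAnnPlusDual.of_laws (g₀ := Φ * f) ?_ ?_ ?_ ?_
  · funext τ; rw [slash_S_apply', Pi.mul_apply, Pi.mul_apply, hgS]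
  · funext τ; rw [slash_T_apply, Pi.mul_apply, Pi.mul_apply, hΦT, hfT]
  · funext τ; rw [slash_S_apply', Pi.mul_apply, Pi.mul_apply, h0S]
  · funext τ
    simp only [Pi.add_apply, Pi.sub_apply, Pi.smul_apply, Pi.mul_apply, smul_eq_mul, slash_T_apply,
      slash_T_inv_apply, hfT, hfT']
    linear_combination (f τ) * hdiff τ

/-- **`φ̃₋₂ f` solves (4.9)** for `f` invariant of weight `k + 2` under `T`, `S`.
[cite: CohnEtAl2019, §4.2 Proposition 4.4] -/
theorem phiTildeNeg2_mul_isAnnPlusDual {k : ℤ} {f : ℍ → ℂ} (hT : f ∣[k + 2] ModularGroup.T = f)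
    (hS : f ∣[k + 2] ModularGroup.S = f) : IsAnnPlusDual k (phiTildeNeg2 * f) := by
  have hfT : ∀ τ : ℍ, f ((1 : ℝ) +ᵥ τ) = f τ := fun τ => by rw [← slash_T_apply f (k + 2) τ, hT]
  have hfT' : ∀ τ : ℍ, f ((-1 : ℝ) +ᵥ τ) = f τ := fun τ => by
    rw [← slash_T_inv_apply f (k + 2) τ, slash_T_inv_of_invariant hT]
  have hfS := apply_S_smul_mul_zpow (k := k) hS
  refine isAnnPlusDual_of_pointwise (Φ := fun _ => 1) hfT hfT' (fun τ => ?_) (fun _ => rfl)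
    (fun τ => ?_) (fun τ => by rw [phiTildeNeg2_second_diff]; ring)
  · rw [mul_assoc, hfS, phiTildeNeg2_S_smul, show k + 2 - k = 2 by ring, zpow_ofNat, ← mul_assoc,
      inv_mul_cancel₀ (pow_ne_zero 2 τ.ne_zero)]
  · rw [mul_assoc, hfS, phiTildeNeg2, show k + 2 - k = 2 by ring, zpow_ofNat]; ring

/-- **`φ̃₀ f` solves (4.9)** for `f` invariant of weight `k` under `T`, `S`.
[cite: CohnEtAl2019, §4.2 Proposition 4.4] -/
theorem phiTilde0_mul_isAnnPlusDual {k : ℤ} {f : ℍ → ℂ} (hT : f ∣[k] ModularGroup.T = f)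
    (hS : f ∣[k] ModularGroup.S = f) : IsAnnPlusDual k (phiTilde0 * f) := by
  have hfT : ∀ τ : ℍ, f ((1 : ℝ) +ᵥ τ) = f τ := fun τ => by rw [← slash_T_apply f k τ, hT]
  have hfT' : ∀ τ : ℍ, f ((-1 : ℝ) +ᵥ τ) = f τ := fun τ => by
    rw [← slash_T_inv_apply f k τ, slash_T_inv_of_invariant hT]
  have hfS := apply_S_smul_mul_zpow (k := k) hS
  refine isAnnPlusDual_of_pointwise (Φ := E2) hfT hfT' (fun τ => ?_) E2_vadd_one
    (fun τ => ?_) (fun τ => by rw [phiTilde0_second_diff])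
  · rw [mul_assoc, hfS, phiTilde0_S_smul, sub_self, zpow_zero, one_mul]
  · rw [mul_assoc, hfS, E2_S_smul, phiTilde0, sub_self, zpow_zero, one_mul]

/-- **`φ̃₂ f` solves (4.9)** for `f` invariant of weight `k − 2` under `T`, `S`.
[cite: CohnEtAl2019, §4.2 Proposition 4.4] -/
theorem phiTilde2_mul_isAnnPlusDual {k : ℤ} {f : ℍ → ℂ} (hT : f ∣[k - 2] ModularGroup.T = f)
    (hS : f ∣[k - 2] ModularGroup.S = f) : IsAnnPlusDual k (phiTilde2 * f) := by
  have hfT : ∀ τ : ℍ, f ((1 : ℝ) +ᵥ τ) = f τ := fun τ => by rw [← slash_T_apply f (k - 2) τ, hT]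
  have hfT' : ∀ τ : ℍ, f ((-1 : ℝ) +ᵥ τ) = f τ := fun τ => by
    rw [← slash_T_inv_apply f (k - 2) τ, slash_T_inv_of_invariant hT]
  have hfS := apply_S_smul_mul_zpow (k := k) hS
  have hτ2 : ∀ τ : ℍ, (τ : ℂ) ^ (k - 2 - k) = ((τ : ℂ) ^ 2)⁻¹ := fun τ => by
    rw [show k - 2 - k = -2 by ring, zpow_neg, zpow_ofNat]
  refine isAnnPlusDual_of_pointwise (Φ := E2 ^ 2) hfT hfT' (fun τ => ?_)
    (fun τ => by simp [E2_vadd_one]) (fun τ => ?_) (fun τ => by rw [phiTilde2_second_diff]; rfl)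
  · rw [mul_assoc, hfS, phiTilde2_S_smul, hτ2, Pi.pow_apply, mul_mul_mul_comm,
      mul_inv_cancel₀ (pow_ne_zero 2 τ.ne_zero), one_mul]
  · have hτ : (τ : ℂ) ≠ 0 := τ.ne_zero
    have hπ : (π : ℂ) ≠ 0 := ofReal_ne_zero.2 Real.pi_ne_zero
    rw [mul_assoc, hfS, Pi.pow_apply, E2_S_smul, phiTilde2, hτ2]
    field_simp

/-! ## `ψ̃₄ = U² − V²`, `ψ̃₂ = W`, `ψ̃₀ = 𝓛` (Proposition 4.5) -/

/-- **`ψ̃₄ = U² − V²`.** [cite: CohnEtAl2019, §4.2 Proposition 4.5] -/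
def psiTilde4 : ℍ → ℂ := thetaU * thetaU - thetaV * thetaV

/-- **`ψ̃₂ = W`.** [cite: CohnEtAl2019, §4.2 Proposition 4.5] -/
def psiTilde2 : ℍ → ℂ := thetaW

/-- **`ψ̃₀ = 𝓛`.** [cite: CohnEtAl2019, §4.2 Proposition 4.5] -/
def psiTilde0 : ℍ → ℂ := logLambda

/-- The generic verification of (4.11) for `g = ψ̃ f` with `ψ̃` of weight `j`, `f` invariant of
weight `k − j`: it suffices that `ψ̃|S =: ψ̃₀` satisfies `ψ̃₀|T = −ψ̃₀`, `ψ̃₀|S = ψ̃`, and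
`ψ̃|T − 2ψ̃ + ψ̃|T⁻¹ + 2ψ̃₀ = 0`. [folklore] -/
theorem isAnnMinusDual_mul {j k : ℤ} {ψ ψ₀ f : ℍ → ℂ} (hψS : ψ ∣[j] ModularGroup.S = ψ₀)
    (h0T : ψ₀ ∣[j] ModularGroup.T = -ψ₀) (h0S : ψ₀ ∣[j] ModularGroup.S = ψ)
    (hsum : ψ ∣[j] ModularGroup.T - (2 : ℂ) • ψ + ψ ∣[j] ModularGroup.T⁻¹ + (2 : ℂ) • ψ₀ = 0)
    (hfT : f ∣[k - j] ModularGroup.T = f) (hfS : f ∣[k - j] ModularGroup.S = f) :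
    IsAnnMinusDual k (ψ * f) := by
  have hk : k = j + (k - j) := by ring
  have hfT' : f ∣[k - j] ModularGroup.T⁻¹ = f := slash_T_inv_of_invariant hfT
  refine IsAnnMinusDual.of_laws (g₀ := ψ₀ * f) ?_ ?_ ?_ ?_
  · rw [hk, mul_slash_SL2, hψS, hfS]
  · rw [hk, mul_slash_SL2, h0T, hfT, neg_mul]
  · rw [hk, mul_slash_SL2, h0S, hfS]
  · rw [hk, mul_slash_SL2, mul_slash_SL2, hfT, hfT']
    have := congrArg (· * f) hsum
    simp only [zero_mul] at this
    rw [← this]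
    funext τ
    simp only [Pi.add_apply, Pi.sub_apply, Pi.mul_apply, Pi.smul_apply, smul_eq_mul]
    ring

/-- **`ψ̃₂ f = W f` solves (4.11)** for `f` invariant of weight `k − 2` (uses the Jacobi identity
`U = V + W`). [cite: CohnEtAl2019, §4.2 Proposition 4.5] -/
theorem psiTilde2_mul_isAnnMinusDual {k : ℤ} {f : ℍ → ℂ} (hT : f ∣[k - 2] ModularGroup.T = f)
    (hS : f ∣[k - 2] ModularGroup.S = f) : IsAnnMinusDual k (psiTilde2 * f) := by
  refine isAnnMinusDual_mul (ψ₀ := -thetaV) thetaW_slash_S ?_ ?_ ?_ hT hS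
  · rw [SlashAction.neg_slash, thetaV_slash_T, neg_neg]
  · rw [SlashAction.neg_slash, thetaV_slash_S, neg_neg]; rfl
  · rw [psiTilde2, thetaW_slash_T, slash_T_inv_eq_of_slash_T thetaU_slash_T, thetaU_eq_thetaV_add_thetaW,
      two_smul, two_smul]
    abel

/-- **`ψ̃₄ f = (U² − V²) f` solves (4.11)** for `f` invariant of weight `k − 4`.
[cite: CohnEtAl2019, §4.2 Proposition 4.5] -/
theorem psiTilde4_mul_isAnnMinusDual {k : ℤ} {f : ℍ → ℂ} (hT : f ∣[k - 4] ModularGroup.T = f)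
    (hS : f ∣[k - 4] ModularGroup.S = f) : IsAnnMinusDual k (psiTilde4 * f) := by
  have h22 : (4 : ℤ) = 2 + 2 := by norm_num
  have hψS : psiTilde4 ∣[(4 : ℤ)] ModularGroup.S = thetaU * thetaU - thetaW * thetaW := by
    rw [psiTilde4, h22, sub_eq_add_neg, SlashAction.add_slash, SlashAction.neg_slash, mul_slash_SL2,
      mul_slash_SL2, thetaU_slash_S, thetaV_slash_S]; ring
  have h0T : (thetaU * thetaU - thetaW * thetaW) ∣[(4 : ℤ)] ModularGroup.T =
      -(thetaU * thetaU - thetaW * thetaW) := by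
    rw [h22, sub_eq_add_neg, SlashAction.add_slash, SlashAction.neg_slash, mul_slash_SL2, mul_slash_SL2,
      thetaU_slash_T, thetaW_slash_T]; ring
  have h0S : (thetaU * thetaU - thetaW * thetaW) ∣[(4 : ℤ)] ModularGroup.S = psiTilde4 := by
    rw [psiTilde4, h22, sub_eq_add_neg, SlashAction.add_slash, SlashAction.neg_slash, mul_slash_SL2,
      mul_slash_SL2, thetaU_slash_S, thetaW_slash_S]; ring
  have hUinv : thetaU ∣[(2 : ℤ)] ModularGroup.T⁻¹ = thetaW := slash_T_inv_eq_of_slash_T thetaW_slash_T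
  have hVinv : thetaV ∣[(2 : ℤ)] ModularGroup.T⁻¹ = -thetaV := by
    have h := slash_T_inv_eq_of_slash_T thetaV_slash_T
    rw [SlashAction.neg_slash, neg_eq_iff_eq_neg] at h
    exact h
  refine isAnnMinusDual_mul hψS h0T h0S ?_ hT hS
  rw [psiTilde4, h22]
  simp only [sub_eq_add_neg, SlashAction.add_slash, SlashAction.neg_slash]
  rw [mul_slash_SL2, mul_slash_SL2, mul_slash_SL2, mul_slash_SL2, thetaU_slash_T, thetaV_slash_T, hUinv,
    hVinv]
  funext τ
  simp only [Pi.add_apply, Pi.mul_apply, Pi.neg_apply, Pi.smul_apply, smul_eq_mul, Pi.zero_apply]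
  ring

/-- `𝓛|₀T⁻¹ = 𝓛 − 𝓛_S − iπ`. [folklore] -/
theorem logLambda_slash_T_inv :
    logLambda ∣[(0 : ℤ)] ModularGroup.T⁻¹ = logLambda - logLambdaS - fun _ => π * I := by
  apply slash_T_inv_eq_of_slash_T
  rw [sub_eq_add_neg, sub_eq_add_neg, SlashAction.add_slash, SlashAction.add_slash,
    SlashAction.neg_slash, SlashAction.neg_slash, logLambda_slash_T, logLambdaS_slash_T]
  funext τ
  simp only [Pi.add_apply, Pi.neg_apply, Pi.sub_apply, slash_T_apply]
  ring

/-- **`ψ̃₀ f = 𝓛 f` solves (4.11)** for `f` invariant of weight `k` (uses the four laws (2.11)).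
[cite: CohnEtAl2019, §4.2 Proposition 4.5] -/
theorem psiTilde0_mul_isAnnMinusDual {k : ℤ} {f : ℍ → ℂ} (hT : f ∣[k] ModularGroup.T = f)
    (hS : f ∣[k] ModularGroup.S = f) : IsAnnMinusDual k (psiTilde0 * f) := by
  refine isAnnMinusDual_mul (j := 0) (ψ₀ := logLambdaS) logLambda_slash_S logLambdaS_slash_T
    logLambdaS_slash_S ?_ (by rw [sub_zero]; exact hT) (by rw [sub_zero]; exact hS)
  rw [psiTilde0, logLambda_slash_T, logLambda_slash_T_inv]
  funext τ
  simp only [Pi.add_apply, Pi.sub_apply, Pi.smul_apply, smul_eq_mul, Pi.zero_apply]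
  ring

/-- Bundled versions for level-one modular forms. [cite: CohnEtAl2019, §4.2 Propositions 4.4–4.5] -/
theorem isAnnDual_of_modularForm (k : ℤ) :
    (∀ f : ModularForm 𝒮ℒ (k + 2), IsAnnPlusDual k (phiTildeNeg2 * ⇑f)) ∧
    (∀ f : ModularForm 𝒮ℒ k, IsAnnPlusDual k (phiTilde0 * ⇑f)) ∧
    (∀ f : ModularForm 𝒮ℒ (k - 2), IsAnnPlusDual k (phiTilde2 * ⇑f)) ∧
    (∀ f : ModularForm 𝒮ℒ (k - 4), IsAnnMinusDual k (psiTilde4 * ⇑f)) ∧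
    (∀ f : ModularForm 𝒮ℒ (k - 2), IsAnnMinusDual k (psiTilde2 * ⇑f)) ∧
    (∀ f : ModularForm 𝒮ℒ k, IsAnnMinusDual k (psiTilde0 * ⇑f)) :=
  ⟨fun f => phiTildeNeg2_mul_isAnnPlusDual (f.slash_action_eq' _ ⟨ModularGroup.T, rfl⟩)
      (f.slash_action_eq' _ ⟨ModularGroup.S, rfl⟩),
   fun f => phiTilde0_mul_isAnnPlusDual (f.slash_action_eq' _ ⟨ModularGroup.T, rfl⟩)
      (f.slash_action_eq' _ ⟨ModularGroup.S, rfl⟩),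
   fun f => phiTilde2_mul_isAnnPlusDual (f.slash_action_eq' _ ⟨ModularGroup.T, rfl⟩)
      (f.slash_action_eq' _ ⟨ModularGroup.S, rfl⟩),
   fun f => psiTilde4_mul_isAnnMinusDual (f.slash_action_eq' _ ⟨ModularGroup.T, rfl⟩)
      (f.slash_action_eq' _ ⟨ModularGroup.S, rfl⟩),
   fun f => psiTilde2_mul_isAnnMinusDual (f.slash_action_eq' _ ⟨ModularGroup.T, rfl⟩)
      (f.slash_action_eq' _ ⟨ModularGroup.S, rfl⟩),
   fun f => psiTilde0_mul_isAnnMinusDual (f.slash_action_eq' _ ⟨ModularGroup.T, rfl⟩)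
      (f.slash_action_eq' _ ⟨ModularGroup.S, rfl⟩)⟩

/-- `Ann_k(𝓘̃₊)` is closed under addition. [folklore] -/
theorem IsAnnPlusDual.add {k : ℤ} {g h : ℍ → ℂ} (hg : IsAnnPlusDual k g) (hh : IsAnnPlusDual k h) :
    IsAnnPlusDual k (g + h) := by
  refine ⟨?_, ?_⟩
  · have := congrArg₂ (· + ·) hg.T_eq hh.T_eq
    simp only [add_zero] at this
    rw [← this]
    simp only [SlashAction.add_slash, smul_add]
    abel
  · have := congrArg₂ (· + ·) hg.STS_eq hh.STS_eq
    simp only [add_zero] at this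
    rw [← this]
    simp only [SlashAction.add_slash]
    abel

/-- `Ann_k(𝓘̃₊)` is closed under scalars. [folklore] -/
theorem IsAnnPlusDual.smul {k : ℤ} {g : ℍ → ℂ} (hg : IsAnnPlusDual k g) (c : ℂ) :
    IsAnnPlusDual k (c • g) := by
  refine ⟨?_, ?_⟩
  · have := congrArg (c • ·) hg.T_eq
    simp only [smul_zero] at this
    rw [← this]
    simp only [SL_smul_slash, smul_add, smul_sub, smul_comm c (2 : ℂ)]
  · have := congrArg (c • ·) hg.STS_eq
    simp only [smul_zero] at this
    rw [← this]
    simp only [SL_smul_slash, smul_sub]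

/-- `Ann_k(𝓘̃₋)` is closed under addition. [folklore] -/
theorem IsAnnMinusDual.add {k : ℤ} {g h : ℍ → ℂ} (hg : IsAnnMinusDual k g) (hh : IsAnnMinusDual k h) :
    IsAnnMinusDual k (g + h) := by
  refine ⟨?_, ?_⟩
  · have := congrArg₂ (· + ·) hg.T_eq hh.T_eq
    simp only [add_zero] at this
    rw [← this]
    simp only [SlashAction.add_slash, smul_add]
    abel
  · have := congrArg₂ (· + ·) hg.STS_eq hh.STS_eq
    simp only [add_zero] at this
    rw [← this]
    simp only [SlashAction.add_slash]
    abel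

/-- `Ann_k(𝓘̃₋)` is closed under scalars. [folklore] -/
theorem IsAnnMinusDual.smul {k : ℤ} {g : ℍ → ℂ} (hg : IsAnnMinusDual k g) (c : ℂ) :
    IsAnnMinusDual k (c • g) := by
  refine ⟨?_, ?_⟩
  · have := congrArg (c • ·) hg.T_eq
    simp only [smul_zero] at this
    rw [← this]
    simp only [SL_smul_slash, smul_add, smul_sub, smul_comm c (2 : ℂ)]
  · have := congrArg (c • ·) hg.STS_eq
    simp only [smul_zero] at this
    rw [← this]
    simp only [SL_smul_slash, smul_add]

end Literature.NumberTheory.ModularForms
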